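import Literature.Topology.FourManifolds.RegularFamilyIsotopy
import Mathlib.Geometry.Manifold.PartitionOfUnity
import Mathlib.Topology.MetricSpace.Thickening
import HarnessLib

/-!
# Verticalising a regular hypersurface near a compact transversal set

Topic `Literature/Topology/FourManifolds`; a normalisation move in the exp-height line of the
fact seat `provefact-Literature.Topology.FourManifolds.SphereEmbedding.schoenflies_exists_ball`
(Alexander's theorem, Schultens (2014), Thm. 3.2.5), built on `RegularFamilyIsotopy.lean`.
**Everything in this file is proved; no definitions, no named facts.**

When a compact regular domain `A = {F ≤ 0}` is cut along a level disc `D ⊂ {⟪v, ·⟫ = a}`, the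
boundary `∂A` crosses the level transversally along the corner circle `C = ∂D`, but at an
arbitrary angle.  All later constructions near the corner (rounding, the flat faces of the
absorbed pieces, the comparison of a capped ball with the model) are simplest when `∂A` is a
**vertical cylinder** near `C`, i.e. when `F` does not depend on the height there.  This file
achieves that by an ambient diffeomorphism:

* `Verticalise.exists_verticalise` — given `v ≠ 0`, a level `a` and a compact set `C₀` at
  whose points `DF` is not a multiple of `⟪v, ·⟫`, there are `ρ, η > 0`, a smooth `F'` and a
  diffeomorphism `Φ` of the ambient space with `Φ(A) = {F' ≤ 0}`, `Φ(∂A) = {F' = 0}`, such that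
  `F' x = F (π x)` (`π` the projection to the level along `v`) whenever
  `π x ∈ cthickening (ρ/2) C₀` and `|⟪v, x⟫ - a| ≤ η`; `F' = F` on the level and off the box
  `{π x ∈ thickening ρ C₀, |⟪v, x⟫ - a| < 2η}`, where also `Φ = id`; `F'` is regular on its
  zero set, transverse to the levels throughout the box, and `{F' ≤ ε₀}` stays in a compact set.

Proof: the family `F ∘ Ξ_τ`, `Ξ_τ x = x - τ χ(π x) β(⟪v, x⟫ - a) v/‖v‖²` — `χ` a smooth
cutoff around `C₀` composed with `π` (so that its gradient is horizontal), `β(t) = t κ(t)` the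
identity cut off to `|t| < 2η` by a plateau cutoff — is a regular family: on horizontal vectors
the derivative of `F ∘ Ξ_τ` is that of `F` at `Ξ_τ x` up to a correction of size
`2η ‖Dχ‖ ‖DF‖/‖v‖`, which for `η` small cannot cancel the transversality margin
`‖DF - (DF v/‖v‖²)⟪v, ·⟫‖ ≥ μ` valid near `C₀` (§2); `RegularFamily.exists_diffeomorph_image_eq`
integrates it.

## References

* J. Schultens, *Introduction to 3-Manifolds*, GSM 151 (2014), Thm. 3.2.5 (PDF pp. 43–45).
  [Schultens2014]
* M. W. Hirsch, *Differential Topology*, GTM 33 (1976), Ch. 8 §1 (isotopies from flows).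
  [HirschDT1976]
-/

open scoped RealInnerProductSpace Topology Manifold ContDiff
open Set Filter Metric Function

noncomputable section

namespace Literature.Topology.FourManifolds

namespace Verticalise

variable {E : Type*} [NormedAddCommGroup E] [InnerProductSpace ℝ E]

/-! ### §1 The level projection `π x = x - ((⟪v, x⟫ - a)/‖v‖²) v` -/

/-- The level projection lands in the level `{⟪v, ·⟫ = a}`. [folklore] -/
theorem inner_proj {v : E} (hv : v ≠ 0) (a : ℝ) (x : E) :
    ⟪v, x - ((⟪v, x⟫ - a) / ‖v‖ ^ 2) • v⟫ = a := by
  have hv2 : ‖v‖ ^ 2 ≠ 0 := pow_ne_zero 2 (norm_ne_zero_iff.2 hv)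
  rw [inner_sub_right, inner_smul_right, real_inner_self_eq_norm_sq]
  field_simp
  ring

/-- The level projection is the identity on the level. [folklore] -/
theorem proj_of_inner_eq {v : E} {a : ℝ} {x : E} (hx : ⟪v, x⟫ = a) :
    x - ((⟪v, x⟫ - a) / ‖v‖ ^ 2) • v = x := by
  rw [hx, sub_self, zero_div, zero_smul, sub_zero]

/-- The level projection is invariant under vertical translations. [folklore] -/
theorem proj_sub_smul {v : E} (hv : v ≠ 0) (a c : ℝ) (x : E) :
    (x - c • v) - ((⟪v, x - c • v⟫ - a) / ‖v‖ ^ 2) • v = x - ((⟪v, x⟫ - a) / ‖v‖ ^ 2) • v := by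
  have hv2 : ‖v‖ ^ 2 ≠ 0 := pow_ne_zero 2 (norm_ne_zero_iff.2 hv)
  rw [inner_sub_right, inner_smul_right, real_inner_self_eq_norm_sq]
  have : (⟪v, x⟫ - c * ‖v‖ ^ 2 - a) / ‖v‖ ^ 2 = (⟪v, x⟫ - a) / ‖v‖ ^ 2 - c := by
    field_simp; ring
  rw [this, sub_smul]
  abel

/-- The vertical displacement of the level projection: `‖x - π x‖ = |⟪v, x⟫ - a|/‖v‖`.
[folklore] -/
theorem norm_sub_proj {v : E} (hv : v ≠ 0) (a : ℝ) (x : E) :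
    ‖x - (x - ((⟪v, x⟫ - a) / ‖v‖ ^ 2) • v)‖ = |⟪v, x⟫ - a| / ‖v‖ := by
  have hvn : 0 < ‖v‖ := norm_pos_iff.2 hv
  rw [sub_sub_cancel, norm_smul, Real.norm_eq_abs, abs_div, abs_of_pos (pow_pos hvn 2)]
  field_simp

/-- Derivative of the level projection: `w ↦ w - (⟪v, w⟫/‖v‖²) v`. [folklore] -/
theorem hasFDerivAt_proj (v : E) (a : ℝ) (x : E) :
    HasFDerivAt (fun x : E => x - ((⟪v, x⟫ - a) / ‖v‖ ^ 2) • v)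
      (ContinuousLinearMap.id ℝ E - (‖v‖ ^ 2)⁻¹ • (innerSL ℝ v).smulRight v) x := by
  have h1 : HasFDerivAt (fun x : E => (⟪v, x⟫ - a) / ‖v‖ ^ 2) ((‖v‖ ^ 2)⁻¹ • innerSL ℝ v) x :=
    ((innerSL ℝ v).hasFDerivAt (x := x)).sub_const a |>.mul_const (‖v‖ ^ 2)⁻¹
  have h2 := h1.smul_const v
  refine ((hasFDerivAt_id x).sub h2).congr_fderiv ?_
  ext w
  simp [ContinuousLinearMap.smulRight_apply, smul_smul]

/-- The derivative of the level projection kills `v`. [folklore] -/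
theorem proj_deriv_apply_self {v : E} (hv : v ≠ 0) :
    (ContinuousLinearMap.id ℝ E - (‖v‖ ^ 2)⁻¹ • (innerSL ℝ v).smulRight v) v = 0 := by
  have hv2 : ‖v‖ ^ 2 ≠ 0 := pow_ne_zero 2 (norm_ne_zero_iff.2 hv)
  simp [ContinuousLinearMap.smulRight_apply, smul_smul, inv_mul_cancel₀ hv2]

/-- The derivative of the level projection fixes vectors orthogonal to `v`. [folklore] -/
theorem proj_deriv_apply_of_inner_eq_zero {v w : E} (hw : ⟪v, w⟫ = 0) :
    (ContinuousLinearMap.id ℝ E - (‖v‖ ^ 2)⁻¹ • (innerSL ℝ v).smulRight v) w = w := by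
  simp [ContinuousLinearMap.smulRight_apply, hw]

/-! ### §2 The horizontal part of a functional and the transversality margin -/

/-- If the horizontal part `A - (A v/‖v‖²)⟪v, ·⟫` of a functional `A` vanishes then `A` is a
multiple of `⟪v, ·⟫`. [folklore] -/
theorem eq_smul_innerSL_of_horizontal_eq_zero {v : E} {A : E →L[ℝ] ℝ}
    (h : A - ((‖v‖ ^ 2)⁻¹ * A v) • innerSL ℝ v = 0) :
    A = ((‖v‖ ^ 2)⁻¹ * A v) • innerSL ℝ v := by
  rwa [sub_eq_zero] at h

/-- The horizontal part of `A` evaluated on a vector orthogonal to `v` is `A` itself.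
[folklore] -/
theorem horizontal_apply_of_inner_eq_zero {v : E} (A : E →L[ℝ] ℝ) {w : E} (hw : ⟪v, w⟫ = 0) :
    (A - ((‖v‖ ^ 2)⁻¹ * A v) • innerSL ℝ v) w = A w := by
  simp [hw]

/-- The horizontal part of `A` kills `v`. [folklore] -/
theorem horizontal_apply_self {v : E} (hv : v ≠ 0) (A : E →L[ℝ] ℝ) :
    (A - ((‖v‖ ^ 2)⁻¹ * A v) • innerSL ℝ v) v = 0 := by
  have hv2 : ‖v‖ ^ 2 ≠ 0 := pow_ne_zero 2 (norm_ne_zero_iff.2 hv)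
  have h : (‖v‖ ^ 2)⁻¹ * A v * ‖v‖ ^ 2 = A v := by field_simp
  simp [h]

/-- **Norm of a horizontal functional from its values on `vᗮ`.**  If a functional `B` kills `v`
and `|B w| ≤ m ‖w‖` for all `w ⊥ v`, then `‖B‖ ≤ m`. [folklore] -/
theorem opNorm_le_of_horizontal {v : E} (hv : v ≠ 0) {B : E →L[ℝ] ℝ} (hBv : B v = 0) {m : ℝ}
    (hm : 0 ≤ m) (h : ∀ w, ⟪v, w⟫ = 0 → |B w| ≤ m * ‖w‖) : ‖B‖ ≤ m := by
  refine ContinuousLinearMap.opNorm_le_bound _ hm fun u => ?_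
  -- split `u = w + c v` with `w ⊥ v`
  set c : ℝ := ⟪v, u⟫ / ‖v‖ ^ 2 with hc
  set w : E := u - c • v with hw
  have hv2 : ‖v‖ ^ 2 ≠ 0 := pow_ne_zero 2 (norm_ne_zero_iff.2 hv)
  have hwv : ⟪v, w⟫ = 0 := by
    rw [hw, inner_sub_right, inner_smul_right, real_inner_self_eq_norm_sq, hc]
    field_simp
    ring
  have hBu : B u = B w := by
    have : u = w + c • v := by rw [hw]; abel
    rw [this, map_add, map_smul, hBv, smul_zero, add_zero]
  have hwle : ‖w‖ ≤ ‖u‖ := by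
    -- `‖u‖² = ‖w‖² + c²‖v‖²`
    have hsq : ‖u‖ ^ 2 = ‖w‖ ^ 2 + ‖c • v‖ ^ 2 := by
      have hu : u = w + c • v := by rw [hw]; abel
      have h0 : ⟪w, c • v⟫ = 0 := by
        rw [inner_smul_right, real_inner_comm v w, hwv, mul_zero]
      rw [hu, sq, sq, sq]
      exact norm_add_sq_eq_norm_sq_add_norm_sq_real h0
    nlinarith [norm_nonneg u, norm_nonneg w, sq_nonneg ‖c • v‖]
  rw [Real.norm_eq_abs, hBu]
  exact (h w hwv).trans (mul_le_mul_of_nonneg_left hwle hm)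

/-! ### §3 The verticalising family -/

section Main

variable [FiniteDimensional ℝ E]

/-- **Verticalising a regular hypersurface near a compact transversal set.**  Let `A = {F ≤ 0}`
be a compact regular domain, `v ≠ 0`, `a` a level and `C₀` a compact set at whose points `DF`
is not a multiple of `⟪v, ·⟫` (in the application: the corner circle `∂A ∩ {⟪v, ·⟫ = a}` of a
level disc, where `∂A` is transverse to the level).  Then `A` is carried by a diffeomorphism of
the ambient space, supported in the box `{π x ∈ thickening ρ C₀, |⟪v, x⟫ - a| < 2η}` over a
neighbourhood of `C₀` (`π` the projection to the level along `v`), onto the domain `{F' ≤ 0}`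
of a smooth function `F'` which **near `C₀` does not depend on the height**:
`F' x = F (π x)` for `π x ∈ cthickening (ρ/2) C₀`, `|⟪v, x⟫ - a| ≤ η` — so that `∂{F' ≤ 0}` is
a vertical cylinder there — agrees with `F` on the level `{⟪v, ·⟫ = a}` and off the box, is
regular on its zero set, and is transverse to the levels throughout the box; off the (open) box
`F'` agrees with `F` together with its derivative; moreover `F` itself is transverse to the
levels on the closed box (which lies inside the transversality
neighbourhood of `C₀`).  Proof: the
family `F ∘ Ξ_τ`, `Ξ_τ x = x - τ χ(π x) β(⟪v, x⟫ - a) v/‖v‖²` (`χ` a cutoff around `C₀`, `β` the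
identity cut off to `|t| < 2η`), is a regular family for `η` small against the transversality
margin (`RegularFamily.exists_diffeomorph_image_eq`). [folklore] -/
theorem exists_verticalise {F : E → ℝ} (hF : ContDiff ℝ ∞ F) {K : Set E} (hK : IsCompact K)
    {ε₀ : ℝ} (hε₀ : 0 < ε₀) (hKF : ∀ x, F x ≤ ε₀ → x ∈ K)
    (hreg : ∀ x, F x = 0 → fderiv ℝ F x ≠ 0) {v : E} (hv : v ≠ 0) {a : ℝ} {C₀ : Set E}
    (hC₀ : IsCompact C₀) (hT : ∀ x ∈ C₀, ∀ c : ℝ, fderiv ℝ F x ≠ c • innerSL ℝ v) :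
    ∃ ρ, 0 < ρ ∧ ∃ η, 0 < η ∧ ∃ F' : E → ℝ, ContDiff ℝ ∞ F' ∧
      (∀ x, F' x = 0 → fderiv ℝ F' x ≠ 0) ∧
      (∀ x, F' x ≤ ε₀ → x ∈ cthickening (2 * η / ‖v‖) K) ∧
      (∀ x, ⟪v, x⟫ = a → F' x = F x) ∧
      (∀ x, (x - ((⟪v, x⟫ - a) / ‖v‖ ^ 2) • v ∉ thickening ρ C₀ ∨ 2 * η ≤ |⟪v, x⟫ - a|) →
        F' x = F x) ∧
      (∀ x, (x - ((⟪v, x⟫ - a) / ‖v‖ ^ 2) • v ∉ thickening ρ C₀ ∨ 2 * η ≤ |⟪v, x⟫ - a|) →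
        fderiv ℝ F' x = fderiv ℝ F x) ∧
      (∀ x, x - ((⟪v, x⟫ - a) / ‖v‖ ^ 2) • v ∈ cthickening (ρ / 2) C₀ → |⟪v, x⟫ - a| ≤ η →
        F' x = F (x - ((⟪v, x⟫ - a) / ‖v‖ ^ 2) • v)) ∧
      (∀ x, x - ((⟪v, x⟫ - a) / ‖v‖ ^ 2) • v ∈ thickening ρ C₀ → |⟪v, x⟫ - a| < 2 * η →
        F' x = 0 → ∀ c : ℝ, fderiv ℝ F' x ≠ c • innerSL ℝ v) ∧
      (∀ x, x - ((⟪v, x⟫ - a) / ‖v‖ ^ 2) • v ∈ cthickening ρ C₀ → |⟪v, x⟫ - a| ≤ 2 * η →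
        ∀ c : ℝ, fderiv ℝ F x ≠ c • innerSL ℝ v) ∧
      ∃ Φ : E ≃ₘ⟮𝓘(ℝ, E), 𝓘(ℝ, E)⟯ E,
        Φ '' {x | F x ≤ 0} = {x | F' x ≤ 0} ∧ Φ '' {x | F x = 0} = {x | F' x = 0} ∧
        (∀ x, (x - ((⟪v, x⟫ - a) / ‖v‖ ^ 2) • v ∉ thickening ρ C₀ ∨ 2 * η ≤ |⟪v, x⟫ - a|) →
          Φ x = x) := by
  -- notation
  have hv2 : ‖v‖ ^ 2 ≠ 0 := pow_ne_zero 2 (norm_ne_zero_iff.2 hv)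
  have hvn : 0 < ‖v‖ := norm_pos_iff.2 hv
  set tf : E → ℝ := fun x => ⟪v, x⟫ - a with htf
  set pr : E → E := fun x => x - ((⟪v, x⟫ - a) / ‖v‖ ^ 2) • v with hpr
  set Dπ : E →L[ℝ] E := ContinuousLinearMap.id ℝ E - (‖v‖ ^ 2)⁻¹ • (innerSL ℝ v).smulRight v
    with hDπ
  have hprd : ∀ x, HasFDerivAt pr Dπ x := fun x => hasFDerivAt_proj v a x
  have hprs : ContDiff ℝ ∞ pr :=
    contDiff_id.sub ((((innerSL ℝ v).contDiff.sub contDiff_const).div_const _).smul contDiff_const)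
  have htfs : ContDiff ℝ ∞ tf := (innerSL ℝ v).contDiff.sub contDiff_const
  have hFd : Differentiable ℝ F := hF.differentiable (by simp)
  have hDFc : Continuous (fderiv ℝ F) := hF.continuous_fderiv (by simp)
  -- the horizontal part of `DF`
  set Lh : E → (E →L[ℝ] ℝ) := fun y =>
    fderiv ℝ F y - ((‖v‖ ^ 2)⁻¹ * fderiv ℝ F y v) • innerSL ℝ v with hLh
  have hLhc : Continuous Lh := by
    have h1 : Continuous fun y => fderiv ℝ F y v :=
      (ContinuousLinearMap.apply ℝ ℝ v).continuous.comp hDFc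
    exact hDFc.sub ((continuous_const.mul h1).smul continuous_const)
  have hLh0 : ∀ y ∈ C₀, Lh y ≠ 0 := fun y hy h =>
    hT y hy _ (eq_smul_innerSL_of_horizontal_eq_zero h)
  -- Step 1: transversality margin `μ` on `thickening ρ₀ C₀`
  obtain ⟨μ, hμ, ρ₀, hρ₀, hmargin⟩ : ∃ μ, 0 < μ ∧ ∃ ρ₀, 0 < ρ₀ ∧
      ∀ y ∈ thickening ρ₀ C₀, μ ≤ ‖Lh y‖ := by
    by_cases hne : C₀.Nonempty
    · obtain ⟨y₀, hy₀, hmin⟩ := hC₀.exists_isMinOn hne (continuous_norm.comp hLhc).continuousOn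
      have hpos : 0 < ‖Lh y₀‖ := norm_pos_iff.2 (hLh0 y₀ hy₀)
      set μ := ‖Lh y₀‖ / 2 with hμdef
      have hU : IsOpen {y | μ < ‖Lh y‖} := isOpen_lt continuous_const (continuous_norm.comp hLhc)
      have hsub : C₀ ⊆ {y | μ < ‖Lh y‖} := fun y hy => by
        have h' : ‖Lh y₀‖ ≤ ‖Lh y‖ := hmin hy
        simp only [mem_setOf_eq]; linarith
      obtain ⟨ρ₀, hρ₀, hthick⟩ := hC₀.exists_thickening_subset_open hU hsub
      exact ⟨μ, by positivity, ρ₀, hρ₀, fun y hy => (hthick hy).le⟩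
    · refine ⟨1, one_pos, 1, one_pos, fun y hy => ?_⟩
      rw [not_nonempty_iff_eq_empty] at hne
      simp [hne] at hy
  -- Step 2: a bound `M` for `‖DF‖` on `cthickening ρ₀ C₀`
  obtain ⟨M, hM0, hM⟩ : ∃ M, 0 < M ∧ ∀ y ∈ cthickening ρ₀ C₀, ‖fderiv ℝ F y‖ ≤ M := by
    obtain ⟨M, hM⟩ := (hC₀.cthickening (r := ρ₀)).exists_bound_of_continuousOn hDFc.continuousOn
    exact ⟨max M 1, by positivity, fun y hy => (hM y hy).trans (le_max_left _ _)⟩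
  -- Step 3: the cutoff `χ` around `C₀`, radius `ρ = ρ₀/2`, and a bound for its derivative
  set ρ : ℝ := ρ₀ / 2 with hρdef
  have hρ : 0 < ρ := by positivity
  obtain ⟨χ, hχ1, hχ0, hχ01⟩ := exists_contMDiffMap_zero_one_of_isClosed 𝓘(ℝ, E)
    (isOpen_thickening.isClosed_compl : IsClosed (thickening ρ C₀)ᶜ)
    (isClosed_cthickening : IsClosed (cthickening (ρ / 2) C₀))
    (by
      rw [Set.disjoint_compl_left_iff_subset]
      exact cthickening_subset_thickening' hρ (by linarith) C₀) (n := (⊤ : ℕ∞))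
  -- note: `hχ1 : EqOn χ 0 (thickening ρ C₀)ᶜ`, `hχ0 : EqOn χ 1 (cthickening (ρ/2) C₀)`
  have hχs : ContDiff ℝ ∞ (χ : E → ℝ) := χ.contMDiff.contDiff
  have hχd : Differentiable ℝ (χ : E → ℝ) := hχs.differentiable (by simp)
  obtain ⟨Cχ, hCχ0, hCχ⟩ : ∃ C, 0 < C ∧ ∀ z, ‖fderiv ℝ (χ : E → ℝ) z‖ ≤ C := by
    have hc : Continuous (fderiv ℝ (χ : E → ℝ)) := hχs.continuous_fderiv (by simp)
    obtain ⟨C, hC⟩ := (hC₀.cthickening (r := ρ)).exists_bound_of_continuousOn hc.continuousOn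
    refine ⟨max C 1, by positivity, fun z => ?_⟩
    by_cases hz : z ∈ cthickening ρ C₀
    · exact (hC z hz).trans (le_max_left _ _)
    · -- off the closed thickening `χ` vanishes near `z`
      have hev : (χ : E → ℝ) =ᶠ[𝓝 z] fun _ => 0 := by
        have hopen : IsOpen (cthickening ρ C₀)ᶜ := isClosed_cthickening.isOpen_compl
        filter_upwards [hopen.mem_nhds hz] with y hy
        exact hχ1 (fun h => hy (thickening_subset_cthickening _ _ h))
      rw [hev.fderiv_eq]
      simp
  -- `χ` vanishes with its derivative off `thickening ρ C₀`
  have hχ_off : ∀ z, z ∉ thickening ρ C₀ → χ z = 0 ∧ fderiv ℝ (χ : E → ℝ) z = 0 := by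
    intro z hz
    have h0 : χ z = 0 := hχ1 hz
    refine ⟨h0, ?_⟩
    have hmin : IsLocalMin (χ : E → ℝ) z :=
      Filter.Eventually.of_forall fun y => by rw [h0]; exact (hχ01 y).1
    exact hmin.fderiv_eq_zero
  -- Step 4: the height cutoff `β(t) = t κ(t)` and the slab height `η`
  set η : ℝ := min (ρ₀ * ‖v‖ / 8) (μ * ‖v‖ / (8 * M * Cχ)) with hηdef
  have hη : 0 < η := by positivity
  have hη1 : 4 * η / ‖v‖ ≤ ρ₀ / 2 := by
    have : η ≤ ρ₀ * ‖v‖ / 8 := min_le_left _ _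
    rw [div_le_iff₀ hvn]; nlinarith
  have hη2 : 2 * η * M * Cχ / ‖v‖ < μ := by
    have : η ≤ μ * ‖v‖ / (8 * M * Cχ) := min_le_right _ _
    rw [div_lt_iff₀ hvn]
    have h8 : η * (8 * M * Cχ) ≤ μ * ‖v‖ := by rwa [le_div_iff₀ (by positivity)] at this
    nlinarith [mul_pos hμ hvn]
  obtain ⟨hκs, hκ1, hκ0⟩ := RegularFamily.plateauCutoff_props (a := η) (b := 2 * η) (by linarith)
  set κ : ℝ → ℝ := fun s => Real.smoothTransition ((s + 2 * η) / (2 * η - η)) *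
    Real.smoothTransition ((2 * η - s) / (2 * η - η)) with hκdef
  have hκ1' : ∀ s, |s| ≤ η → κ s = 1 := hκ1
  have hκ0' : ∀ s, 2 * η ≤ |s| → κ s = 0 := hκ0
  have hκ01 : ∀ s, 0 ≤ κ s ∧ κ s ≤ 1 := fun s =>
    ⟨mul_nonneg (Real.smoothTransition.nonneg _) (Real.smoothTransition.nonneg _),
      mul_le_one₀ (Real.smoothTransition.le_one _) (Real.smoothTransition.nonneg _)
        (Real.smoothTransition.le_one _)⟩
  set β : ℝ → ℝ := fun s => s * κ s with hβdef
  have hβs : ContDiff ℝ ∞ β := contDiff_id.mul hκs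
  have hβd : Differentiable ℝ β := hβs.differentiable (by simp)
  have hβ_abs : ∀ s, |β s| ≤ 2 * η := by
    intro s
    by_cases hs : 2 * η ≤ |s|
    · have : β s = 0 := by simp only [hβdef, hκ0' s hs, mul_zero]
      rw [this, abs_zero]; positivity
    · push Not at hs
      have : |β s| = |s| * κ s := by
        simp only [hβdef]; rw [abs_mul, abs_of_nonneg (hκ01 s).1]
      rw [this]
      nlinarith [(hκ01 s).2, (hκ01 s).1, abs_nonneg s]
  have hβ_of_le : ∀ s, |s| ≤ η → β s = s := fun s hs => by
    simp only [hβdef, hκ1' s hs, mul_one]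
  have hβ_of_ge : ∀ s, 2 * η ≤ |s| → β s = 0 := fun s hs => by
    simp only [hβdef, hκ0' s hs, mul_zero]
  have hβ0 : β 0 = 0 := by simp only [hβdef, zero_mul]
  have hβ_deriv : ∀ s, 2 * η ≤ |s| → deriv β s = 0 := by
    intro s hs
    rcases le_or_gt 0 s with hs0 | hs0
    · -- `β ≥ 0 = β s` on `s ≥ 0`: local minimum
      rw [abs_of_nonneg hs0] at hs
      apply IsLocalMin.deriv_eq_zero
      have hpos : 0 < s := by linarith
      filter_upwards [Ioi_mem_nhds hpos] with u hu
      rw [hβ_of_ge s (by rw [abs_of_nonneg hs0]; exact hs)]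
      exact mul_nonneg (le_of_lt hu) (hκ01 u).1
    · rw [abs_of_neg hs0] at hs
      apply IsLocalMax.deriv_eq_zero
      filter_upwards [Iio_mem_nhds hs0] with u hu
      rw [hβ_of_ge s (by rw [abs_of_neg hs0]; exact hs)]
      exact mul_nonpos_of_nonpos_of_nonneg (le_of_lt hu) (hκ01 u).1
  -- Step 6: the family `Ξ_τ x = x - (τ φ(x)/‖v‖²) v`, `φ = (χ ∘ π) · (β ∘ t)`
  set φ : E → ℝ := fun x => χ (pr x) * β (tf x) with hφ
  have hφs : ContDiff ℝ ∞ φ := (hχs.comp hprs).mul (hβs.comp htfs)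
  have hφ_abs : ∀ x, |φ x| ≤ 2 * η := fun x => by
    simp only [hφ]; rw [abs_mul, abs_of_nonneg (hχ01 _).1]
    exact (mul_le_of_le_one_left (abs_nonneg _) (hχ01 _).2).trans (hβ_abs _)
  set Ξ : ℝ → E → E := fun τ x => x - ((τ * φ x) / ‖v‖ ^ 2) • v with hΞ
  set G : ℝ × E → ℝ := fun p => F (Ξ p.1 p.2) with hG
  have hΞs : ContDiff ℝ ∞ fun p : ℝ × E => Ξ p.1 p.2 :=
    contDiff_snd.sub (((contDiff_fst.mul (hφs.comp contDiff_snd)).div_const _).smul contDiff_const)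
  have hGs : ContDiff ℝ ∞ G := hF.comp hΞs
  -- basic identities along the family
  have hpr_Ξ : ∀ τ x, pr (Ξ τ x) = pr x := fun τ x => proj_sub_smul hv a _ x
  have htf_Ξ : ∀ τ x, tf (Ξ τ x) = tf x - τ * φ x := fun τ x => by
    simp only [htf, hΞ, inner_sub_right, inner_smul_right, real_inner_self_eq_norm_sq]
    field_simp
    ring
  have hdist_Ξ : ∀ τ, τ ∈ Icc (0 : ℝ) 1 → ∀ x, dist (Ξ τ x) x ≤ 2 * η / ‖v‖ := by
    intro τ hτ x
    rw [dist_eq_norm]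
    have h1 : ‖Ξ τ x - x‖ = |τ * φ x| / ‖v‖ := by
      simp only [hΞ, sub_sub_cancel_left, norm_neg, norm_smul, Real.norm_eq_abs, abs_div,
        abs_of_pos (pow_pos hvn 2)]
      field_simp
    rw [h1, div_le_div_iff_of_pos_right hvn, abs_mul, abs_of_nonneg hτ.1]
    exact (mul_le_of_le_one_left (abs_nonneg _) hτ.2).trans (hφ_abs x)
  have hy_near : ∀ τ, τ ∈ Icc (0 : ℝ) 1 → ∀ x, pr x ∈ thickening ρ C₀ → |tf x| < 2 * η →
      Ξ τ x ∈ thickening ρ₀ C₀ := by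
    intro τ hτ x hx ht
    obtain ⟨z, hz, hdz⟩ := mem_thickening_iff.1 hx
    refine mem_thickening_iff.2 ⟨z, hz, ?_⟩
    have h1 : dist (Ξ τ x) (pr (Ξ τ x)) ≤ 4 * η / ‖v‖ := by
      rw [dist_eq_norm]
      have := norm_sub_proj hv a (Ξ τ x)
      simp only [hpr] at this ⊢
      rw [this, div_le_div_iff_of_pos_right hvn]
      have h2 : |tf (Ξ τ x)| ≤ 4 * η := by
        rw [htf_Ξ]
        have := hφ_abs x
        have h3 : |τ * φ x| ≤ 2 * η := by
          rw [abs_mul, abs_of_nonneg hτ.1]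
          exact (mul_le_of_le_one_left (abs_nonneg _) hτ.2).trans this
        calc |tf x - τ * φ x| ≤ |tf x| + |τ * φ x| := abs_sub _ _
          _ ≤ 4 * η := by linarith
      exact h2
    rw [hpr_Ξ] at h1
    calc dist (Ξ τ x) z ≤ dist (Ξ τ x) (pr x) + dist (pr x) z := dist_triangle _ _ _
      _ < 4 * η / ‖v‖ + ρ := by linarith
      _ ≤ ρ₀ := by rw [hρdef]; linarith
  -- Step 7: the derivative on horizontal vectors and on `v`
  have hderiv : ∀ τ x, ∃ D : E →L[ℝ] ℝ, HasFDerivAt (fun y => G (τ, y)) D x ∧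
      (∀ w, ⟪v, w⟫ = 0 → D w = fderiv ℝ F (Ξ τ x) w -
        (τ * β (tf x) / ‖v‖ ^ 2) * fderiv ℝ (χ : E → ℝ) (pr x) w * fderiv ℝ F (Ξ τ x) v) ∧
      D v = (1 - τ * χ (pr x) * deriv β (tf x)) * fderiv ℝ F (Ξ τ x) v := by
    intro τ x
    have hχ' : HasFDerivAt (fun y => χ (pr y)) ((fderiv ℝ (χ : E → ℝ) (pr x)).comp Dπ) x :=
      (hχd (pr x)).hasFDerivAt.comp x (hprd x)
    have hβ' : HasFDerivAt (fun y => β (tf y)) ((fderiv ℝ β (tf x)).comp (innerSL ℝ v)) x := by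
      have ht : HasFDerivAt tf (innerSL ℝ v) x :=
        ((innerSL ℝ v).hasFDerivAt (x := x)).sub_const a
      exact (hβd (tf x)).hasFDerivAt.comp x ht
    have hφ' := hχ'.mul hβ'
    set φ' : E →L[ℝ] ℝ := χ (pr x) • (fderiv ℝ β (tf x)).comp (innerSL ℝ v) +
      β (tf x) • (fderiv ℝ (χ : E → ℝ) (pr x)).comp Dπ with hφ'def
    have h1 : HasFDerivAt (fun y => (τ * φ y * (‖v‖ ^ 2)⁻¹) • v)
        (((‖v‖ ^ 2)⁻¹ • (τ • φ')).smulRight v) x :=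
      ((hφ'.const_mul τ).mul_const (‖v‖ ^ 2)⁻¹).smul_const v
    have hΞ' : HasFDerivAt (Ξ τ)
        (ContinuousLinearMap.id ℝ E - ((‖v‖ ^ 2)⁻¹ • (τ • φ')).smulRight v) x :=
      (hasFDerivAt_id (𝕜 := ℝ) x).sub h1
    have hG' : HasFDerivAt (fun y => G (τ, y)) ((fderiv ℝ F (Ξ τ x)).comp
        (ContinuousLinearMap.id ℝ E - ((‖v‖ ^ 2)⁻¹ • (τ • φ')).smulRight v)) x :=
      (hFd (Ξ τ x)).hasFDerivAt.comp x hΞ'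
    refine ⟨_, hG', fun w hw => ?_, ?_⟩
    · have hDπw : Dπ w = w := proj_deriv_apply_of_inner_eq_zero hw
      have hφ'w : φ' w = β (tf x) * fderiv ℝ (χ : E → ℝ) (pr x) w := by
        simp only [hφ'def, add_apply, smul_apply,
          ContinuousLinearMap.comp_apply, innerSL_apply_apply, hw, map_zero, smul_eq_mul,
          mul_zero, zero_add, hDπw]
      simp only [ContinuousLinearMap.comp_apply, sub_apply,
        ContinuousLinearMap.id_apply, ContinuousLinearMap.smulRight_apply,
        smul_apply, map_sub, map_smul, smul_eq_mul, hφ'w]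
      field_simp
    · have hDπv : Dπ v = 0 := proj_deriv_apply_self hv
      have hφ'v : φ' v = χ (pr x) * (deriv β (tf x) * ‖v‖ ^ 2) := by
        simp only [hφ'def, add_apply, smul_apply,
          ContinuousLinearMap.comp_apply, innerSL_apply_apply, hDπv, map_zero, smul_eq_mul,
          mul_zero, add_zero, real_inner_self_eq_norm_sq]
        rw [← toSpanSingleton_deriv]
        simp [mul_comm]
      simp only [ContinuousLinearMap.comp_apply, sub_apply,
        ContinuousLinearMap.id_apply, ContinuousLinearMap.smulRight_apply,
        smul_apply, map_sub, map_smul, smul_eq_mul, hφ'v]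
      field_simp
  -- Step 8: regularity of the family and transversality in the box
  have hLh_of : ∀ y, (∀ w, ⟪v, w⟫ = 0 → |fderiv ℝ F y w| ≤ 0) → Lh y = 0 := by
    intro y h
    have := opNorm_le_of_horizontal hv (horizontal_apply_self hv (fderiv ℝ F y)) le_rfl
      (fun w hw => by rw [horizontal_apply_of_inner_eq_zero _ hw, zero_mul]; exact h w hw)
    exact norm_le_zero_iff.1 this
  have hkey : ∀ τ ∈ Icc (0 : ℝ) 1, ∀ x, G (τ, x) = 0 → ∀ c : ℝ,
      fderiv ℝ (fun y => G (τ, y)) x = c • innerSL ℝ v →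
        (c = 0 → False) ∧ (pr x ∈ thickening ρ C₀ → |tf x| < 2 * η → False) := by
    intro τ hτ x hx0 c hc
    obtain ⟨D, hD, hDw, hDv⟩ := hderiv τ x
    have hDeq : D = c • innerSL ℝ v := by rw [← hD.fderiv, hc]
    set y := Ξ τ x with hy
    have hFy : F y = 0 := hx0
    have hDFy : fderiv ℝ F y ≠ 0 := hreg y hFy
    -- [*]: on horizontal vectors
    have hstar : ∀ w, ⟪v, w⟫ = 0 → fderiv ℝ F y w =
        (τ * β (tf x) / ‖v‖ ^ 2) * fderiv ℝ (χ : E → ℝ) (pr x) w * fderiv ℝ F y v := by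
      intro w hw
      have := hDw w hw
      rw [hDeq] at this
      simp only [smul_apply, innerSL_apply_apply, hw, smul_eq_mul, mul_zero] at this
      linarith
    -- the case where the correction vanishes: `φ` and `Dχ ∘ π` vanish at `x`
    have htriv : (β (tf x) = 0 ∧ deriv β (tf x) = 0) ∨
        (χ (pr x) = 0 ∧ fderiv ℝ (χ : E → ℝ) (pr x) = 0) → c = 0 → False := by
      intro hcase hc0
      have hφ0 : φ x = 0 := by
        rcases hcase with ⟨h, -⟩ | ⟨h, -⟩ <;> simp [hφ, h]
      have hyx : y = x := by simp [hy, hΞ, hφ0]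
      have hw0 : ∀ w, ⟪v, w⟫ = 0 → fderiv ℝ F y w = 0 := by
        intro w hw
        rw [hstar w hw]
        rcases hcase with ⟨h, -⟩ | ⟨-, h⟩ <;> simp [h]
      have hlam : (1 - τ * χ (pr x) * deriv β (tf x)) = 1 := by
        rcases hcase with ⟨-, h⟩ | ⟨h, -⟩ <;> simp [h]
      have hv0 : fderiv ℝ F y v = 0 := by
        have := hDv
        rw [hDeq, hlam, one_mul, hc0, zero_smul] at this
        simpa using this.symm
      apply hDFy
      have hL := hLh_of y fun w hw => by rw [hw0 w hw, abs_zero]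
      have := eq_smul_innerSL_of_horizontal_eq_zero (v := v) (A := fderiv ℝ F y) hL
      rw [this, hv0, mul_zero, zero_smul]
    -- the case of the box: the margin
    have hbox : pr x ∈ thickening ρ C₀ → |tf x| < 2 * η → False := by
      intro hpx htx
      have hynear : y ∈ thickening ρ₀ C₀ := hy_near τ hτ x hpx htx
      have hμy := hmargin y hynear
      have hMy := hM y (thickening_subset_cthickening _ _ hynear)
      have hbound : ∀ w, ⟪v, w⟫ = 0 → |fderiv ℝ F y w| ≤ (2 * η * M * Cχ / ‖v‖) * ‖w‖ := by
        intro w hw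
        rw [hstar w hw, abs_mul, abs_mul]
        have h1 : |τ * β (tf x) / ‖v‖ ^ 2| ≤ 2 * η / ‖v‖ ^ 2 := by
          rw [abs_div, abs_of_pos (pow_pos hvn 2), div_le_div_iff_of_pos_right (pow_pos hvn 2),
            abs_mul, abs_of_nonneg hτ.1]
          exact (mul_le_of_le_one_left (abs_nonneg _) hτ.2).trans (hβ_abs _)
        have h2 : |fderiv ℝ (χ : E → ℝ) (pr x) w| ≤ Cχ * ‖w‖ := by
          rw [← Real.norm_eq_abs]; exact (ContinuousLinearMap.le_opNorm _ _).trans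
            (mul_le_mul_of_nonneg_right (hCχ _) (norm_nonneg _))
        have h3 : |fderiv ℝ F y v| ≤ M * ‖v‖ := by
          rw [← Real.norm_eq_abs]; exact (ContinuousLinearMap.le_opNorm _ _).trans
            (mul_le_mul_of_nonneg_right hMy (norm_nonneg _))
        calc |τ * β (tf x) / ‖v‖ ^ 2| * |fderiv ℝ (χ : E → ℝ) (pr x) w| * |fderiv ℝ F y v|
            ≤ (2 * η / ‖v‖ ^ 2) * (Cχ * ‖w‖) * (M * ‖v‖) := by gcongr
          _ = (2 * η * M * Cχ / ‖v‖) * ‖w‖ := by field_simp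
      have hle := opNorm_le_of_horizontal hv (horizontal_apply_self hv (fderiv ℝ F y))
        (m := 2 * η * M * Cχ / ‖v‖) (by positivity)
        (fun w hw => by rw [horizontal_apply_of_inner_eq_zero _ hw]; exact hbound w hw)
      have : ‖Lh y‖ ≤ 2 * η * M * Cχ / ‖v‖ := hle
      linarith
    refine ⟨fun hc0 => ?_, hbox⟩
    -- regularity: reduce to the two trivial cases or the box
    by_cases htx : 2 * η ≤ |tf x|
    · exact htriv (Or.inl ⟨hβ_of_ge _ htx, hβ_deriv _ htx⟩) hc0
    · push Not at htx
      by_cases hpx : pr x ∈ thickening ρ C₀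
      · exact hbox hpx htx
      · exact htriv (Or.inr (hχ_off _ hpx)) hc0
  have hregG : ∀ τ ∈ Icc (0 : ℝ) 1, ∀ x, G (τ, x) = 0 → fderiv ℝ (fun y => G (τ, y)) x ≠ 0 :=
    fun τ hτ x hx h => (hkey τ hτ x hx 0 (by rw [h, zero_smul])).1 rfl
  -- Step 9: the isotopy lemma
  have hKG' : ∀ τ ∈ Icc (0 : ℝ) 1, ∀ x, G (τ, x) ≤ ε₀ → x ∈ cthickening (2 * η / ‖v‖) K := by
    intro τ hτ x hx
    have hyK : Ξ τ x ∈ K := hKF _ hx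
    rw [mem_cthickening_iff]
    refine (Metric.infEDist_le_edist_of_mem hyK).trans ?_
    rw [edist_dist, dist_comm]
    exact ENNReal.ofReal_le_ofReal (hdist_Ξ τ hτ x)
  have hKG : ∀ τ ∈ Icc (0 : ℝ) 1, ∀ x, |G (τ, x)| ≤ ε₀ → x ∈ cthickening (2 * η / ‖v‖) K :=
    fun τ hτ x hx => hKG' τ hτ x ((le_abs_self _).trans hx)
  obtain ⟨Φ, hle, heq, -, hfix, -⟩ := RegularFamily.exists_diffeomorph_image_eq hGs
    (hK.cthickening (r := 2 * η / ‖v‖)) hε₀ hKG hregG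
  -- Step 10: conclusions; `F' = G (1, ·)`
  have hG0 : ∀ x, G (0, x) = F x := fun x => by simp [hG, hΞ]
  have hout : ∀ x, (pr x ∉ thickening ρ C₀ ∨ 2 * η ≤ |tf x|) → φ x = 0 := by
    intro x hx
    rcases hx with hx | hx
    · simp [hφ, (hχ_off _ hx).1]
    · simp [hφ, hβ_of_ge _ hx]
  -- off the box `F' = F` to first order: `φ` vanishes there together with its derivative
  have hDout : ∀ x, (pr x ∉ thickening ρ C₀ ∨ 2 * η ≤ |tf x|) →
      fderiv ℝ (fun y => G (1, y)) x = fderiv ℝ F x := by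
    intro x hx
    have hφx : φ x = 0 := hout x hx
    have hχ' : HasFDerivAt (fun y => χ (pr y)) ((fderiv ℝ (χ : E → ℝ) (pr x)).comp Dπ) x :=
      (hχd (pr x)).hasFDerivAt.comp x (hprd x)
    have hβ' : HasFDerivAt (fun y => β (tf y)) ((fderiv ℝ β (tf x)).comp (innerSL ℝ v)) x := by
      have ht : HasFDerivAt tf (innerSL ℝ v) x :=
        ((innerSL ℝ v).hasFDerivAt (x := x)).sub_const a
      exact (hβd (tf x)).hasFDerivAt.comp x ht
    have hφ' := hχ'.mul hβ'
    have hzero : χ (pr x) • (fderiv ℝ β (tf x)).comp (innerSL ℝ v) +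
        β (tf x) • (fderiv ℝ (χ : E → ℝ) (pr x)).comp Dπ = 0 := by
      rcases hx with hx | hx
      · obtain ⟨h0, hD0⟩ := hχ_off _ hx
        rw [h0, hD0]; simp
      · have hb0 : β (tf x) = 0 := hβ_of_ge _ hx
        have hDb : fderiv ℝ β (tf x) = 0 := by
          have h1 : deriv β (tf x) = 0 := hβ_deriv _ hx
          ext1; rw [← toSpanSingleton_deriv, h1]; simp
        rw [hb0, hDb]; simp
    have hφ'0 : HasFDerivAt φ (0 : E →L[ℝ] ℝ) x := by
      rw [← hzero]
      exact hφ'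
    have h1 : HasFDerivAt (fun y => (1 * φ y * (‖v‖ ^ 2)⁻¹) • v) (0 : E →L[ℝ] E) x := by
      have := ((hφ'0.const_mul (1 : ℝ)).mul_const (‖v‖ ^ 2)⁻¹).smul_const v
      simpa using this
    have hΞ' : HasFDerivAt (Ξ 1) (ContinuousLinearMap.id ℝ E) x := by
      have := (hasFDerivAt_id (𝕜 := ℝ) x).sub h1
      simp only [sub_zero] at this
      refine this.congr_of_eventuallyEq (Filter.Eventually.of_forall fun y => ?_)
      simp only [hΞ, Pi.sub_apply, id_eq]
      rw [div_eq_mul_inv]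
    have hΞx : Ξ 1 x = x := by simp [hΞ, hφx]
    have hG' : HasFDerivAt (fun y => G (1, y)) ((fderiv ℝ F (Ξ 1 x)).comp (ContinuousLinearMap.id ℝ E)) x :=
      (hFd (Ξ 1 x)).hasFDerivAt.comp x hΞ'
    rw [hG'.fderiv, hΞx, ContinuousLinearMap.comp_id]
  have hstat : ∀ x, φ x = 0 → ∀ τ ∈ Icc (0 : ℝ) 1, fderiv ℝ G (τ, x) (1, 0) = 0 := by
    intro x hx τ _
    -- `G (·, x)` is constant in `τ`
    have hconst : ∀ σ, G (σ, x) = F x := fun σ => by simp [hG, hΞ, hx]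
    have hGd : DifferentiableAt ℝ G (τ, x) := hGs.differentiable (by simp) _
    have hc1 : HasDerivAt (fun σ : ℝ => ((σ, x) : ℝ × E)) ((1 : ℝ), (0 : E)) τ :=
      (hasDerivAt_id τ).prodMk (hasDerivAt_const τ x)
    have h1 : HasDerivAt (G ∘ fun σ : ℝ => ((σ, x) : ℝ × E)) (fderiv ℝ G (τ, x) ((1 : ℝ), (0 : E))) τ :=
      hGd.hasFDerivAt.comp_hasDerivAt τ hc1
    have h2 : HasDerivAt (G ∘ fun σ : ℝ => ((σ, x) : ℝ × E)) 0 τ := by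
      have : (G ∘ fun σ : ℝ => ((σ, x) : ℝ × E)) = fun _ => F x := funext fun σ => hconst σ
      rw [this]; exact hasDerivAt_const τ (F x)
    exact h1.unique h2
  refine ⟨ρ, hρ, η, hη, fun x => G (1, x), hGs.comp (contDiff_const.prodMk contDiff_id),
    fun x hx => ?_, fun x hx => hKG' 1 ⟨zero_le_one, le_rfl⟩ x hx, fun x hx => ?_,
    fun x hx => ?_, fun x hx => hDout x hx, fun x hpx htx => ?_, fun x hpx htx hx0 c hc => ?_,
    fun x hpx htx c hc => ?_, Φ, ?_, ?_, fun x hx => ?_⟩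
  · -- regularity of `F'`
    have := hregG 1 ⟨zero_le_one, le_rfl⟩ x hx
    rwa [show (fun y => G (1, y)) = fun x => G (1, x) from rfl] at this
  · -- on the level: `Ξ = id`
    have htf0 : tf x = 0 := by simp [htf, hx]
    have : φ x = 0 := by simp [hφ, htf0, hβ0]
    simp [hG, hΞ, this]
  · -- off the box
    simp [hG, hΞ, hout x hx]
  · -- in the inner box: `F' = F ∘ π`
    have hχ1x : χ (pr x) = 1 := hχ0 hpx
    have hβx : β (tf x) = tf x := hβ_of_le _ htx
    have : Ξ 1 x = pr x := by
      rw [show Ξ 1 x = x - ((1 * φ x) / ‖v‖ ^ 2) • v from rfl,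
        show φ x = χ (pr x) * β (tf x) from rfl, hχ1x, hβx]
      simp only [one_mul, htf, hpr]
    show F (Ξ 1 x) = F (pr x)
    rw [this]
  · -- transversality in the box
    exact (hkey 1 ⟨zero_le_one, le_rfl⟩ x hx0 c hc).2 hpx htx
  · -- transversality of `F` itself on the closed box: the box lies in `thickening ρ₀ C₀`
    have hxnear : x ∈ thickening ρ₀ C₀ := by
      rw [Metric.mem_thickening_iff_infEDist_lt]
      have h1 : Metric.infEDist x C₀ ≤ Metric.infEDist (pr x) C₀ + edist x (pr x) :=
        Metric.infEDist_le_infEDist_add_edist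
      have h2 : Metric.infEDist (pr x) C₀ ≤ ENNReal.ofReal ρ := mem_cthickening_iff.1 hpx
      have h3 : dist x (pr x) ≤ 2 * η / ‖v‖ := by
        rw [dist_eq_norm]
        have := norm_sub_proj hv a x
        simp only [hpr] at this ⊢
        rw [this, div_le_div_iff_of_pos_right hvn]
        exact htx
      have h4 : edist x (pr x) ≤ ENNReal.ofReal (2 * η / ‖v‖) := by
        rw [edist_dist]; exact ENNReal.ofReal_le_ofReal h3
      calc Metric.infEDist x C₀ ≤ ENNReal.ofReal ρ + ENNReal.ofReal (2 * η / ‖v‖) := h1.trans (add_le_add h2 h4)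
        _ = ENNReal.ofReal (ρ + 2 * η / ‖v‖) := (ENNReal.ofReal_add hρ.le (by positivity)).symm
        _ < ENNReal.ofReal ρ₀ := by
          rw [ENNReal.ofReal_lt_ofReal_iff hρ₀]
          have : 2 * η / ‖v‖ ≤ ρ₀ / 4 := by
            rw [div_le_iff₀ hvn]; have := hη1; rw [div_le_iff₀ hvn] at this; linarith
          rw [hρdef]; linarith
    have hμx := hmargin x hxnear
    have hLx : Lh x = 0 := by
      simp only [hLh, hc, FunLike.coe_smul, Pi.smul_apply, innerSL_apply_apply, real_inner_self_eq_norm_sq,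
        smul_eq_mul]
      rw [show (‖v‖ ^ 2)⁻¹ * (c * ‖v‖ ^ 2) = c by field_simp, sub_self]
    rw [hLx, norm_zero] at hμx
    linarith
  · have h0 : {x | F x ≤ 0} = {x | G (0, x) ≤ 0} := by ext x; simp [hG0]
    rw [h0, hle]
  · have h0 : {x | F x = 0} = {x | G (0, x) = 0} := by ext x; simp [hG0]
    rw [h0, heq]
  · exact hfix x (hstat x (hout x hx))

end Main

end Verticalise

end Literature.Topology.FourManifolds

end
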